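import Mathlib
import Summits.Ventures.PercRepro2.HCovCovariance

/-!
# The crux `HCov_all` as a covariance inequality on every finite graph
(blind cell PercRepro2, typer-1 g15, 2026-08-26)

`HCovCovariance.lean` reads (HCOV) on one instance as
`D · cov[1_{b∈U}, 1_{o∈U}; μ[|PD]] ≤ P(Q) · cov[σ_b, F; μ[|Q]]` when `0 < P(Q)` and `0 < D`.
Here the degenerate cases are absorbed (`HCov_iff_covariance'`: when `P(Q) = 0` or `D = 0` the
cleared form `Gc` vanishes and (HCOV) holds trivially), and the closure statement of record
`CovForm.HCov_all ℝ` (every finite graph, every marking with distinct marks, every admissible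
real weight vector) is restated as a covariance inequality for Mathlib's product Bernoulli
measure (`HCov_all_iff_covariance`).  Own work; standard axioms.
-/

namespace Summit.Ventures.PercRepro2

open MeasureTheory ProbabilityTheory MeasureBridge

namespace CovForm

section One

variable {V : Type*} {E : Type*} [Fintype E] [DecidableEq E] [DecidableEq V]

omit [DecidableEq V] in
/-- **(HCOV) ↔ the covariance inequality, degenerate cases absorbed**:
`HCov ↔ (0 < P(Q) → 0 < D → D · cov[1_{b∈U}, 1_{o∈U}; μ[|PD]] ≤ P(Q) · cov[σ_b, F; μ[|Q]])`. -/
theorem HCov_iff_covariance' (p : E → ℝ) (hp : IsProbVec p) (ends : E → Sym2 V)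
    (o a₁ a₂ a₃ b : V) :
    HCov p ends o a₁ a₂ a₃ b ↔
      (0 < prob p (avoidAll ends a₂ {a₁}) → 0 < prob p (PDEvent ends a₁ a₂ a₃) →
        prob p (PDEvent ends a₁ a₂ a₃) *
            cov[inU ends a₁ a₂ b, inU ends a₁ a₂ o;
              (percMeasureOf p hp)[|PDEvent ends a₁ a₂ a₃]] ≤
          prob p (avoidAll ends a₂ {a₁}) *
            cov[sigma ends a₁ a₂ b, Ffun ends o a₁ a₂ a₃ (gamma p ends o a₁ a₂ a₃);
              (percMeasureOf p hp)[|avoidAll ends a₂ {a₁}]]) := by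
  constructor
  · intro h hQ hD
    exact (HCov_iff_covariance p hp ends o a₁ a₂ a₃ b hQ hD).1 h
  · intro h
    by_cases hQ : 0 < prob p (avoidAll ends a₂ {a₁})
    · by_cases hD : 0 < prob p (PDEvent ends a₁ a₂ a₃)
      · exact (HCov_iff_covariance p hp ends o a₁ a₂ a₃ b hQ hD).2 (h hQ hD)
      · have hD0 : prob p (PDEvent ends a₁ a₂ a₃) = 0 :=
          le_antisymm (not_lt.1 hD) (prob_nonneg hp _)
        unfold HCov
        rw [Gc_eq_covariance p hp, hD0]
        simp
    · have hQ0 : prob p (avoidAll ends a₂ {a₁}) = 0 :=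
        le_antisymm (not_lt.1 hQ) (prob_nonneg hp _)
      unfold HCov
      rw [Gc_eq_covariance p hp, hQ0]
      simp

end One

/-- **The crux of record as a covariance inequality on every finite graph**: `HCov_all ℝ` holds
iff for every finite graph, every marking with distinct marks and every admissible real weight
vector `p`, whenever `0 < P(Q)` and `0 < D`,
`D · cov[1_{b∈U}, 1_{o∈U}; μ[|PD]] ≤ P(Q) · cov[σ_b, F; μ[|Q]]` with `μ = percMeasureOf p hp` the
product Bernoulli measure. -/
theorem HCov_all_iff_covariance :
    HCov_all ℝ ↔
      ∀ (V E : Type) [Fintype V] [DecidableEq V] [Fintype E] [DecidableEq E]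
        (ends : E → Sym2 V) (p : E → ℝ) (hp : IsProbVec p) (o a₁ a₂ a₃ b : V),
        a₁ ≠ a₂ → a₁ ≠ a₃ → a₂ ≠ a₃ → o ≠ a₁ → o ≠ a₂ → o ≠ a₃ → o ≠ b →
          b ≠ a₁ → b ≠ a₂ → b ≠ a₃ →
          0 < prob p (avoidAll ends a₂ {a₁}) → 0 < prob p (PDEvent ends a₁ a₂ a₃) →
            prob p (PDEvent ends a₁ a₂ a₃) *
                cov[inU ends a₁ a₂ b, inU ends a₁ a₂ o;
                  (percMeasureOf p hp)[|PDEvent ends a₁ a₂ a₃]] ≤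
              prob p (avoidAll ends a₂ {a₁}) *
                cov[sigma ends a₁ a₂ b, Ffun ends o a₁ a₂ a₃ (gamma p ends o a₁ a₂ a₃);
                  (percMeasureOf p hp)[|avoidAll ends a₂ {a₁}]] := by
  unfold HCov_all
  constructor
  · intro h V E _ _ _ _ ends p hp o a₁ a₂ a₃ b h1 h2 h3 h4 h5 h6 h7 h8 h9 h10 hQ hD
    exact (HCov_iff_covariance p hp ends o a₁ a₂ a₃ b hQ hD).1
      (h V E ends p hp o a₁ a₂ a₃ b h1 h2 h3 h4 h5 h6 h7 h8 h9 h10)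
  · intro h V E _ _ _ _ ends p hp o a₁ a₂ a₃ b h1 h2 h3 h4 h5 h6 h7 h8 h9 h10
    exact (HCov_iff_covariance' p hp ends o a₁ a₂ a₃ b).2
      (h V E ends p hp o a₁ a₂ a₃ b h1 h2 h3 h4 h5 h6 h7 h8 h9 h10)

end CovForm

end Summit.Ventures.PercRepro2
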